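import Summits.AtomisticToContinuum.FouriersLaw.Theorems.BondHeatUncertaintyBoundedResponseOddSectorGreenKuboA
import HarnessLib

/-!
# BondHeatUncertainty / BoundedResponse — «OddSectorGreenKubo / IntensiveOddCorrector» (lens-1 g102 NODE 102, REV ac250516): part 2 of 2 (sequel of `…OddSectorGreenKuboA`, whose module docstring describes the node)

Split for the 400-line cap by the landing lane (hand-2 g37).  This part: §3 CORE `E_N² ≤ (C_J/4T⁴)·N/(N−1)²·oddDefect(μ_T) h₀`, §4 the odd-sector ladder `OddCorrectorGrade s ⟹ ExponentFloor ((1−s)/2)`,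
§5 the current-corrector ladder factors through the odd sector, §6 sharpness.  Same namespace, section, opens and variables; all FQNs unchanged; bodies verbatim.  0 sorry; standard axioms.
-/

noncomputable section

open MeasureTheory ProbabilityTheory Filter Topology Set Function
open scoped NNReal ENNReal
open Literature.MathematicalPhysics.KineticTheory.HeatConduction
open Literature.MathematicalPhysics.KineticTheory OscillatorChain
open Literature.MathematicalPhysics.KineticTheory.HeatConduction.HardTether (leftEnergy blockWeight bondWeight)
open Summit.AtomisticToContinuum.FouriersLaw.Theorems.SubdiffusiveBondHeat
open Summit.AtomisticToContinuum.FouriersLaw.Theorems.SubdiffusiveBondHeat.EscapeGrading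
open Summit.AtomisticToContinuum.FouriersLaw.Theorems.OddSectorIrreversibility
open Summit.AtomisticToContinuum.FouriersLaw.Theorems.BoundedResponse.TransientContact
  (ExtensiveBlockEnergyVariance blockEnergyLeft blockEnergyLeftVar)
open Summit.AtomisticToContinuum.FouriersLaw.Cruxes.SuperadditiveResistance.FloatingProbeBypassLaplacian
  (integral_flip_gibbsMeasure integrable_flip_gibbsMeasure measurePreserving_flip_gibbsMeasure)

namespace Summit.AtomisticToContinuum.FouriersLaw.Theorems.BoundedResponse.ParityFloor

open Summit.AtomisticToContinuum.FouriersLaw.Theses.BondHeatUncertainty (BoundedResponse)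
open Summit.AtomisticToContinuum.FouriersLaw.Theses.OddSectorIrreversibility (ConeScaleCorrector)
open Summit.AtomisticToContinuum.FouriersLaw.Theorems.NonBallistic (exists_totalCurrent_sq_le)
open Summit.AtomisticToContinuum.FouriersLaw.Theorems.ExtensiveSnapshotIrreversibility.ClausiusBudget
  (leftEnergy_neg_momentum)
open Summit.AtomisticToContinuum.FouriersLaw.Cruxes.SuperadditiveResistance.InsertionToolbox (sq_integral_mul_le)

section OddSectorGreenKubo

variable {ω₂ lam β γ T : ℝ} {N : ℕ}

/-! ## §3 CORE: `E_N² ≤ (C_J/4T⁴)·N/(N−1)²·oddDefect(μ_T) h₀` -/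

/-- ★★ **CORE fixed-`N` inequality.** For every `T > 0` there is `C = C_J/(4T⁴) ≥ 0` (`C_J` the `N`-uniform static constant of
`exists_totalCurrent_sq_le`) with, for every `N ≥ 2`,
`E_N(T)² ≤ C · N/(N−1)² · oddDefect(μ_T^N)(h₀)`:  the odd pairing of §2, Cauchy–Schwarz, `‖J‖²_{μ_T} ≤ C_J N`.
Read forwards it is the ladder of §4; read backwards («a conductor forces odd weight») it says `oddDefect ≥ c·E_N²·N`.
[folklore] -/
theorem sq_escapeDeficit_le_oddDefect (hω : 0 < ω₂) (hl : 0 < lam) (hβ : 0 < β) (hγ : 0 < γ) (hT : 0 < T) :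
    ∃ C : ℝ, 0 ≤ C ∧ ∀ N : ℕ, 2 ≤ N → ∀ hN : 0 < N,
      escapeDeficit ω₂ lam β γ T N ^ 2 ≤
        C * ((N : ℝ) / ((N : ℝ) - 1) ^ 2) *
          oddDefect ((pinnedChain ω₂ lam β γ).gibbsMeasure N T) (kinCorrector ω₂ lam β γ T N ⟨0, hN⟩) := by
  obtain ⟨CJ, hCJ0, hJb⟩ := exists_totalCurrent_sq_le hω hl.le hβ.le γ hT
  refine ⟨CJ / (4 * T ^ 4), by positivity, fun N hN2 hN => ?_⟩
  have hE := escapeDeficit_eq_oddCorrector_current_pairing hω hl hβ hγ hT hN2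
  have hw := hJb N
  set P := pinnedChain ω₂ lam β γ with hP
  set π := P.gibbsMeasure N T with hπ
  haveI : IsProbabilityMeasure π := pinnedChain_isProbabilityMeasure_gibbsMeasure hω hl.le hβ.le γ N hT
  set J : PhaseSpace N → ℝ := fun z => ∑ i : Fin N, P.bondCurrent N i z with hJ
  set h0 : PhaseSpace N → ℝ := kinCorrector ω₂ lam β γ T N ⟨0, hN⟩ with hh0
  set Z : ℝ := ∫ x : PhaseSpace N, Real.exp (-(P.hamiltonian N x) / T) with hZ
  have hZpos : 0 < Z := OddResponseBound.Intensive.integral_gibbsWeight_pos hω hl.le hβ.le γ N hT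
  have hsmul := OddResponseBound.Intensive.withDensity_gibbs_eq_smul_gibbsMeasure hω hl.le hβ.le γ N hT
  -- statics on `π`: `∫ J² dπ ≤ C_J N`
  rw [OddResponseBound.Intensive.integral_eq_toReal_mul_of_eq_smul hsmul, ENNReal.toReal_ofReal hZpos.le] at hw
  change Z * ∫ z, J z ^ 2 ∂π ≤ CJ * (N : ℝ) * Z at hw
  have hJπ : ∫ z, J z ^ 2 ∂π ≤ CJ * (N : ℝ) := by
    refine le_of_mul_le_mul_left ?_ hZpos
    calc Z * ∫ z, J z ^ 2 ∂π ≤ CJ * (N : ℝ) * Z := hw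
      _ = Z * (CJ * (N : ℝ)) := by ring
  -- square-integrability
  obtain ⟨h0sm, h0sq, h0sm', h0sq'⟩ := corrector_sq_facts hω hl.le hβ hγ hN hT (⟨0, hN⟩ : Fin N)
  have h0m : MemLp h0 2 π := (memLp_two_iff_integrable_sq h0sm.aestronglyMeasurable).2 h0sq
  have h0m' : MemLp (fun z : PhaseSpace N => h0 (z.1, -z.2)) 2 π :=
    (memLp_two_iff_integrable_sq h0sm'.aestronglyMeasurable).2 h0sq'
  have hom : MemLp (fun z : PhaseSpace N => h0 z - h0 (z.1, -z.2)) 2 π := h0m.sub h0m'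
  have hJc : Continuous J := pinnedChain_continuous_sum_bondCurrent
  have hJ2 : Integrable (fun z => J z ^ 2) π := (pinnedChain_sq_act_sum_bondCurrent hω hl.le hβ hγ hN hT 0).1
  have hJm : MemLp J 2 π := (memLp_two_iff_integrable_sq hJc.aestronglyMeasurable).2 hJ2
  -- Cauchy–Schwarz
  have hCS := sq_integral_mul_le (ν := π) hom hJm
  change (∫ z, (h0 z - h0 (z.1, -z.2)) * J z ∂π) ^ 2 ≤ oddDefect π h0 * ∫ z, J z ^ 2 ∂π at hCS
  set I := ∫ z, (h0 z - h0 (z.1, -z.2)) * J z ∂π with hI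
  change escapeDeficit ω₂ lam β γ T N = -(1 / (2 * T ^ 2 * ((N : ℝ) - 1))) * I at hE
  show escapeDeficit ω₂ lam β γ T N ^ 2 ≤ CJ / (4 * T ^ 4) * ((N : ℝ) / ((N : ℝ) - 1) ^ 2) * oddDefect π h0
  have hN1 : (0 : ℝ) < (N : ℝ) - 1 := by
    have h2 : (2 : ℝ) ≤ N := by exact_mod_cast hN2
    linarith
  have hod0 : 0 ≤ oddDefect π h0 := oddDefect_nonneg _ _
  calc escapeDeficit ω₂ lam β γ T N ^ 2 = (1 / (4 * T ^ 4 * ((N : ℝ) - 1) ^ 2)) * I ^ 2 := by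
        rw [hE]
        field_simp
        ring
    _ ≤ (1 / (4 * T ^ 4 * ((N : ℝ) - 1) ^ 2)) * (oddDefect π h0 * (CJ * (N : ℝ))) :=
        mul_le_mul_of_nonneg_left (hCS.trans (mul_le_mul_of_nonneg_left hJπ hod0)) (by positivity)
    _ = CJ / (4 * T ^ 4) * ((N : ℝ) / ((N : ℝ) - 1) ^ 2) * oddDefect π h0 := by
        field_simp

/-- The CORE read backwards: **a conductor forces odd weight** — for `N ≥ 2`, `(N−1)²/N · E_N² ≤ C · oddDefect(μ_T) h₀`, so an
eventual floor `E_N ≥ e₀ > 0` (phonon corner; `EscapeInfZero` false) makes the odd defect of `h₀` grow at least LINEARLY in `N`.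
[folklore] -/
theorem sq_escapeDeficit_mul_le_oddDefect (hω : 0 < ω₂) (hl : 0 < lam) (hβ : 0 < β) (hγ : 0 < γ) (hT : 0 < T) :
    ∃ C : ℝ, 0 ≤ C ∧ ∀ N : ℕ, 2 ≤ N → ∀ hN : 0 < N,
      ((N : ℝ) - 1) ^ 2 / (N : ℝ) * escapeDeficit ω₂ lam β γ T N ^ 2 ≤
        C * oddDefect ((pinnedChain ω₂ lam β γ).gibbsMeasure N T) (kinCorrector ω₂ lam β γ T N ⟨0, hN⟩) := by
  obtain ⟨C, hC0, hC⟩ := sq_escapeDeficit_le_oddDefect hω hl hβ hγ hT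
  refine ⟨C, hC0, fun N hN2 hN => ?_⟩
  have h := hC N hN2 hN
  have hN1 : (0 : ℝ) < (N : ℝ) - 1 := by
    have h2 : (2 : ℝ) ≤ N := by exact_mod_cast hN2
    linarith
  have hn0 : (0 : ℝ) < N := by exact_mod_cast hN
  have hpos : 0 < ((N : ℝ) - 1) ^ 2 / (N : ℝ) := by positivity
  calc ((N : ℝ) - 1) ^ 2 / (N : ℝ) * escapeDeficit ω₂ lam β γ T N ^ 2
      ≤ ((N : ℝ) - 1) ^ 2 / (N : ℝ) * (C * ((N : ℝ) / ((N : ℝ) - 1) ^ 2) *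
          oddDefect ((pinnedChain ω₂ lam β γ).gibbsMeasure N T) (kinCorrector ω₂ lam β γ T N ⟨0, hN⟩)) :=
        mul_le_mul_of_nonneg_left h hpos.le
    _ = C * oddDefect ((pinnedChain ω₂ lam β γ).gibbsMeasure N T) (kinCorrector ω₂ lam β γ T N ⟨0, hN⟩) := by
        field_simp

/-! ## §4 The odd-sector ladder: `OddCorrectorGrade s ⟹ ExponentFloor ((1−s)/2)` (no time side) -/

/-- ★★ **THE LADDER MAP (Oᶜ_s) ⟹ F((1−s)/2).** `OddCorrectorGrade s → ExponentFloor ((1 − s)/2)` for EVERY real `s`: the CORE,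
`N/(N−1)² ≤ 4/N`, square root.  Tags of the rungs it feeds: `s = −1 ↦ F(1) ⟺ 11071`; `s = 0 ↦ F(1/2) = HalfOhmicFloor`;
`s = 1 ↦ F(0)` (PROVED anyway); `−1 < s < 1 ↦ F((1−s)/2)` WEAKER than 11071 (implied by it, `exponentFloor_of_boundedResponse`;
not known to imply it).  Piece (Oᶜ_s): UNDECIDED (stated test: log–log slope of the two-replica estimate of `N ↦ oddDefect(μ_T^N) h₀`
is `≤ s`) · INSTRUMENTABLE · phonon-FALSE for `s < 1`. [folklore] -/
theorem exponentFloor_of_oddCorrectorGrade {s : ℝ} (hO : OddCorrectorGrade s) : ExponentFloor ((1 - s) / 2) := by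
  intro ω₂ lam β γ hω hl hβ hγ T hT
  obtain ⟨C, N₀, hC⟩ := hO ω₂ lam β γ hω hl hβ hγ T hT
  obtain ⟨K, hK0, hK⟩ := sq_escapeDeficit_le_oddDefect hω hl hβ hγ hT
  refine ⟨Real.sqrt (4 * K * max C 0), max N₀ 2, fun N hN => ?_⟩
  have hN2 : 2 ≤ N := le_trans (le_max_right _ _) hN
  have hN₀ : N₀ ≤ N := le_trans (le_max_left _ _) hN
  have hNpos : 0 < N := by omega
  have hn2 : (2 : ℝ) ≤ N := by exact_mod_cast hN2
  have hn0 : (0 : ℝ) < N := by linarith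
  have hod := hC N hNpos hN₀
  have h1 := hK N hN2 hNpos
  have hfrac : (N : ℝ) / ((N : ℝ) - 1) ^ 2 ≤ 4 / (N : ℝ) := by
    rw [div_le_div_iff₀ (by nlinarith) hn0]
    nlinarith
  have hNs : 0 ≤ (N : ℝ) ^ s := Real.rpow_nonneg hn0.le s
  have h2 : escapeDeficit ω₂ lam β γ T N ^ 2 ≤ 4 * K * max C 0 * (N : ℝ) ^ (s - 1) := by
    calc escapeDeficit ω₂ lam β γ T N ^ 2
        ≤ K * ((N : ℝ) / ((N : ℝ) - 1) ^ 2) * (max C 0 * (N : ℝ) ^ s) :=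
          h1.trans (mul_le_mul_of_nonneg_left (hod.trans (mul_le_mul_of_nonneg_right (le_max_left _ _) hNs))
            (by positivity))
      _ ≤ K * (4 / (N : ℝ)) * (max C 0 * (N : ℝ) ^ s) :=
          mul_le_mul_of_nonneg_right (mul_le_mul_of_nonneg_left hfrac hK0) (by positivity)
      _ = 4 * K * max C 0 * ((N : ℝ) ^ s / (N : ℝ)) := by ring
      _ = 4 * K * max C 0 * (N : ℝ) ^ (s - 1) := by rw [Real.rpow_sub_one hn0.ne']
  have hsq : Real.sqrt (4 * K * max C 0 * (N : ℝ) ^ (s - 1)) =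
      Real.sqrt (4 * K * max C 0) / (N : ℝ) ^ ((1 - s) / 2) := by
    rw [Real.sqrt_mul (by positivity) ((N : ℝ) ^ (s - 1)), Real.sqrt_eq_rpow ((N : ℝ) ^ (s - 1)),
      ← Real.rpow_mul hn0.le, show (s - 1) * (1 / (2 : ℝ)) = -((1 - s) / 2) by ring, Real.rpow_neg hn0.le]
    exact (div_eq_mul_inv _ _).symm
  calc escapeDeficit ω₂ lam β γ T N ≤ |escapeDeficit ω₂ lam β γ T N| := le_abs_self _
    _ ≤ Real.sqrt (4 * K * max C 0 * (N : ℝ) ^ (s - 1)) := Real.abs_le_sqrt h2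
    _ = Real.sqrt (4 * K * max C 0) / (N : ℝ) ^ ((1 - s) / 2) := hsq

/-- ★ **11071 ⟸ (O₋₁ᶜ): the INTENSIVE ODD CORRECTOR door.** `OddCorrectorGrade (−1) → BoundedResponse` — `oddDefect(μ_T^N) h₀ ≤ C/N`
eventually (`‖h₀^odd‖² = O(1/N)`, the diffusive prediction for a sum of local current correctors with summable correlations) gives
`E_N ≤ C′/N`, i.e. 11071 (`exponentFloor_one_iff_boundedResponse`), with NO time-side partner.  Tag of (O₋₁ᶜ): UNDECIDED
(stated test: log–log slope `−1` vs `+1` of `oddDefect(μ_T^N) h₀`) · INSTRUMENTABLE · SUFFICIENT for 11071, not known NECESSARY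
(STRONGER-LEANING flag: the converse needs Cauchy–Schwarz saturation `h₀^odd ∥ J`) · phonon-FALSE like 11071. [folklore] -/
theorem boundedResponse_of_oddCorrectorGrade_neg_one (hO : OddCorrectorGrade (-1)) : BoundedResponse := by
  have h := exponentFloor_of_oddCorrectorGrade hO
  norm_num at h
  exact exponentFloor_one_iff_boundedResponse.1 h

/-- 11071 ⟸ (Oᶜ_s) for every `s ≤ −1` (monotone to `s = −1`). [frame] -/
theorem boundedResponse_of_oddCorrectorGrade_of_le {s : ℝ} (hs : s ≤ -1) (hO : OddCorrectorGrade s) : BoundedResponse :=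
  boundedResponse_of_oddCorrectorGrade_neg_one (oddCorrectorGrade_mono hs hO)

/-- ★ **`HalfOhmicFloor` ⟸ (Oᶜ_0):** an EXTENSIVE-FREE odd defect (`oddDefect(μ_T^N) h₀ = O(1)`) already gives `E_N ≤ C/√N` — the
landing point of E1 (`halfOhmicFloor_of_coneScaleCorrector`) reached from the odd sector alone. [folklore] -/
theorem halfOhmicFloor_of_oddCorrectorGrade_zero (hO : OddCorrectorGrade 0) : HalfOhmicFloor := by
  have h := exponentFloor_of_oddCorrectorGrade hO
  norm_num at h
  exact h

/-- **Bigraded door (Oᶜ_s) ∧ B((1−s)/2) ⟹ 11071** — the odd grade lands on the rung `F((1−s)/2)`; the graded bootstrap of gen 55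
lifts it.  Formally genuine for `−1 < s < 1`; both halves UNDECIDED. [frame] -/
theorem boundedResponse_of_oddCorrectorGrade_of_bootstrap {s : ℝ} (hO : OddCorrectorGrade s)
    (hB : ExponentBootstrap ((1 - s) / 2)) : BoundedResponse :=
  boundedResponse_of_floor_bootstrap _ (exponentFloor_of_oddCorrectorGrade hO) hB

/-- **Bigraded door (Oᶜ_s) ∧ BufferedJunctionLaw ⟹ 11071** for `−1 ≤ s < 1` (tree kernel
`JunctionDefectGrading.boundedResponse_of_bufferedJunctionLaw_of_exponentFloor` at the rung `(1−s)/2 ∈ (0,1]`). [kernel · frame] -/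
theorem boundedResponse_of_oddCorrectorGrade_of_bufferedJunctionLaw {s : ℝ} (hs1 : -1 ≤ s) (hs : s < 1)
    (hO : OddCorrectorGrade s) (hB : JunctionDefectGrading.BufferedJunctionLaw) : BoundedResponse :=
  JunctionDefectGrading.boundedResponse_of_bufferedJunctionLaw_of_exponentFloor (s := (1 - s) / 2)
    (by linarith) (by linarith) hB (exponentFloor_of_oddCorrectorGrade hO)

/-! ## §5 The current-corrector ladder factors through the odd sector: `CCB(a) ⟹ (Oᶜ_{a−2})` -/

/-- ★ **`CurrentCorrectorBudget a → OddCorrectorGrade (a − 2)`.**  At `N ≥ 2`: `γ²(N−1)²·oddDefect(μ_T) h₀ = oddDefect(μ_T) u_N`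
(the committor identity and its `Θ`-transport; the block energies are even), `oddDefect u_N ≤ 4‖u_N‖²_{μ_T}` (`oddDefect_le_four_mul`)
and `‖u_N‖²_{μ_T} ≤ C·N^a` (CCB at `u = u_N`, `d(e^{−H/T}dx) = Z·μ_T`); `(N−1)² ≥ N²/4`.  So E1 = CCB(2) ⟹ (Oᶜ_0), (C₁) ≡ CCB(3) ⟹ (Oᶜ_1)
(g101's `oddCorrectorGrade_of_correctorGrade` again), CCB(1) ⟹ (O₋₁ᶜ). [folklore] -/
theorem oddCorrectorGrade_of_currentCorrectorBudget {a : ℝ} (hE : CurrentCorrectorBudget a) : OddCorrectorGrade (a - 2) := by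
  intro ω₂ lam β γ hω hl hβ hγ T hT
  obtain ⟨C, hCN⟩ := hE ω₂ lam β γ hω hl hβ hγ T hT
  refine ⟨16 * max C 0 / γ ^ 2, 2, fun N hN hN2 => ?_⟩
  have hbud0 := hCN N
  set P := pinnedChain ω₂ lam β γ with hP
  set π := P.gibbsMeasure N T with hπ
  haveI : IsProbabilityMeasure π := pinnedChain_isProbabilityMeasure_gibbsMeasure hω hl.le hβ.le γ N hT
  set J : PhaseSpace N → ℝ := fun z => ∑ i : Fin N, P.bondCurrent N i z with hJ
  set h0 : PhaseSpace N → ℝ := kinCorrector ω₂ lam β γ T N ⟨0, hN⟩ with hh0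
  set uN : PhaseSpace N → ℝ := fun z => ∫ s in Ioi (0 : ℝ), ∫ y, J y
      ∂(P.transitionKernel N T T s.toNNReal z) with huN
  set S : Finset (Fin N) := Finset.univ.filter (fun i : Fin N => i.val + 1 < N) with hS
  set A : PhaseSpace N → ℝ := fun z => ∑ i ∈ S, (leftEnergy P N i z - ∫ x, leftEnergy P N i x ∂π) with hA
  set Z : ℝ := ∫ x : PhaseSpace N, Real.exp (-(P.hamiltonian N x) / T) with hZ
  have hZpos : 0 < Z := OddResponseBound.Intensive.integral_gibbsWeight_pos hω hl.le hβ.le γ N hT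
  have hsmul := OddResponseBound.Intensive.withDensity_gibbs_eq_smul_gibbsMeasure hω hl.le hβ.le γ N hT
  show oddDefect π h0 ≤ 16 * max C 0 / γ ^ 2 * (N : ℝ) ^ (a - 2)
  have hn2 : (2 : ℝ) ≤ N := by exact_mod_cast hN2
  have hn0 : (0 : ℝ) < N := by linarith
  have hN1 : (0 : ℝ) < (N : ℝ) - 1 := by linarith
  -- `u_N` facts and CCB at `u := u_N` (the finite-horizon integrals converge at EVERY point)
  obtain ⟨husm, husq, -, htend⟩ := totalKubo_facts hω hl hβ hγ hT hN
  change StronglyMeasurable uN at husm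
  change Integrable (fun z => uN z ^ 2) π at husq
  have hlimT : ∀ᵐ x ∂(volume.withDensity fun x : PhaseSpace N =>
      ENNReal.ofReal (Real.exp (-(P.hamiltonian N x) / T))),
      Tendsto (fun τ : ℝ => ∫ t in Ioc (0 : ℝ) τ, (∫ y, J y ∂(P.transitionKernel N T T t.toNNReal x)))
        atTop (𝓝 (uN x)) :=
    ae_of_all _ (fun x => htend x)
  have hbud := (hbud0 uN hlimT).2
  rw [OddResponseBound.Intensive.integral_eq_toReal_mul_of_eq_smul hsmul, ENNReal.toReal_ofReal hZpos.le] at hbud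
  change Z * ∫ z, uN z ^ 2 ∂π ≤ C * (N : ℝ) ^ a * Z at hbud
  have hNa : 0 ≤ (N : ℝ) ^ a := Real.rpow_nonneg hn0.le a
  have hu2 : ∫ z, uN z ^ 2 ∂π ≤ max C 0 * (N : ℝ) ^ a := by
    refine le_of_mul_le_mul_left ?_ hZpos
    calc Z * ∫ z, uN z ^ 2 ∂π ≤ C * (N : ℝ) ^ a * Z := hbud
      _ ≤ max C 0 * (N : ℝ) ^ a * Z :=
          mul_le_mul_of_nonneg_right (mul_le_mul_of_nonneg_right (le_max_left _ _) hNa) hZpos.le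
      _ = Z * (max C 0 * (N : ℝ) ^ a) := by ring
  -- the committor identity, here and at `Θz`
  have hAe : ∀ᵐ z ∂π, γ * ((N : ℝ) - 1) * h0 z = A z - uN z :=
    kinCorrector_committor_ae_eq hω hl hβ hγ hT hN2
  have hAeΘ : ∀ᵐ z ∂π, γ * ((N : ℝ) - 1) * h0 (z.1, -z.2) = A (z.1, -z.2) - uN (z.1, -z.2) := by
    have h := (measurePreserving_flip_gibbsMeasure P N T).quasiMeasurePreserving.ae hAe
    simpa only [momentumReversal_apply] using h
  have hAeven : ∀ x : PhaseSpace N, A (x.1, -x.2) = A x := fun x => by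
    simp only [hA, leftEnergy_neg_momentum]
  have hod : (γ * ((N : ℝ) - 1)) ^ 2 * oddDefect π h0 = oddDefect π uN := by
    unfold oddDefect
    rw [← integral_const_mul]
    refine integral_congr_ae ?_
    filter_upwards [hAe, hAeΘ] with z hz hzΘ
    rw [hAeven] at hzΘ
    have e : uN z - uN (z.1, -z.2) = -(γ * ((N : ℝ) - 1)) * (h0 z - h0 (z.1, -z.2)) := by linarith
    rw [e]
    ring
  have h4 : oddDefect π uN ≤ 4 * ∫ z, uN z ^ 2 ∂π := oddDefect_le_four_mul P N T husm husq
  have key : oddDefect π h0 * (γ * ((N : ℝ) - 1)) ^ 2 ≤ 4 * (max C 0 * (N : ℝ) ^ a) := by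
    rw [mul_comm, hod]
    exact h4.trans (by linarith [hu2])
  have hγc : 0 < (γ * ((N : ℝ) - 1)) ^ 2 := by positivity
  have hcmp : γ ^ 2 * (N : ℝ) ^ 2 / 4 ≤ (γ * ((N : ℝ) - 1)) ^ 2 := by
    have h1 : (N : ℝ) ^ 2 / 4 ≤ ((N : ℝ) - 1) ^ 2 := by nlinarith
    calc γ ^ 2 * (N : ℝ) ^ 2 / 4 = γ ^ 2 * ((N : ℝ) ^ 2 / 4) := by ring
      _ ≤ γ ^ 2 * ((N : ℝ) - 1) ^ 2 := mul_le_mul_of_nonneg_left h1 (sq_nonneg γ)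
      _ = (γ * ((N : ℝ) - 1)) ^ 2 := by ring
  calc oddDefect π h0 ≤ 4 * (max C 0 * (N : ℝ) ^ a) / (γ * ((N : ℝ) - 1)) ^ 2 := (le_div_iff₀ hγc).2 key
    _ ≤ 4 * (max C 0 * (N : ℝ) ^ a) / (γ ^ 2 * (N : ℝ) ^ 2 / 4) :=
        div_le_div_of_nonneg_left (by positivity) (by positivity) hcmp
    _ = 16 * max C 0 / γ ^ 2 * ((N : ℝ) ^ a / (N : ℝ) ^ (2 : ℝ)) := by
        rw [Real.rpow_two]
        field_simp
        ring
    _ = 16 * max C 0 / γ ^ 2 * (N : ℝ) ^ (a - 2) := by rw [← Real.rpow_sub hn0]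

/-- **E1 ⟹ (Oᶜ_0):** `ConeScaleCorrector → OddCorrectorGrade 0` (E1 = CCB(2), `currentCorrectorBudget_two_of_coneScaleCorrector`).
So the crux E1 of route `OddSectorIrreversibility` would make the odd defect of `h₀` EXTENSIVE-FREE; with §4 this re-derives
`halfOhmicFloor_of_coneScaleCorrector` through the odd sector. [frame] -/
theorem oddCorrectorGrade_zero_of_coneScaleCorrector (hE : ConeScaleCorrector) : OddCorrectorGrade 0 := by
  have h := oddCorrectorGrade_of_currentCorrectorBudget (currentCorrectorBudget_two_of_coneScaleCorrector hE)
  norm_num at h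
  exact h

/-- **Factorisation of gen 57's ladder through the odd sector:** `CCB(a) ⟹ (Oᶜ_{a−2}) ⟹ F((3−a)/2)` re-proves
`exponentFloor_of_currentCorrectorBudget` — the even (committor) part of `u_N`, of size `N³`, never mattered for `E_N`. [frame] -/
theorem exponentFloor_of_currentCorrectorBudget_via_oddSector {a : ℝ} (hE : CurrentCorrectorBudget a) :
    ExponentFloor ((3 - a) / 2) := by
  have h := exponentFloor_of_oddCorrectorGrade (oddCorrectorGrade_of_currentCorrectorBudget hE)
  rw [show (1 - (a - 2)) / 2 = (3 - a) / 2 by ring] at h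
  exact h

/-! ## §6 Sharpness: a conductor forces odd weight (the phonon corner kills every (Oᶜ_s), `s < 1`) -/

/-- **No sub-extensive odd grade at a conducting point.** If at some admissible parameter point the escape deficit has an
eventual floor `E_N ≥ e₀ > 0` (ballistic contact: the phonon corner `lam = β = 0` in evidence, or any point where `EscapeInfZero`
fails), then `OddCorrectorGrade s` is FALSE for every `s < 1` — the honest falsity region of the new pieces, equal to 11071's.
[folklore] -/
theorem not_oddCorrectorGrade_of_escapeFloor {s : ℝ} (hs : s < 1)
    (hfloor : ∃ ω₂ lam β γ T : ℝ, 0 < ω₂ ∧ 0 < lam ∧ 0 < β ∧ 0 < γ ∧ 0 < T ∧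
      ∃ e₀ : ℝ, 0 < e₀ ∧ ∃ N₁ : ℕ, ∀ N : ℕ, N₁ ≤ N → e₀ ≤ escapeDeficit ω₂ lam β γ T N) :
    ¬ OddCorrectorGrade s := by
  intro hO
  obtain ⟨ω₂, lam, β, γ, T, hω, hl, hβ, hγ, hT, e₀, he₀, N₁, hfl⟩ := hfloor
  have ha : 0 < (1 - s) / 2 := by linarith
  obtain ⟨C, N₀, hC⟩ := exponentFloor_of_oddCorrectorGrade hO ω₂ lam β γ hω hl hβ hγ T hT
  have hev : ∀ᶠ N : ℕ in atTop, C / e₀ + 1 ≤ (N : ℝ) ^ ((1 - s) / 2) := by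
    have h1 : Tendsto (fun N : ℕ => (N : ℝ) ^ ((1 - s) / 2)) atTop atTop :=
      (tendsto_rpow_atTop ha).comp tendsto_natCast_atTop_atTop
    exact h1.eventually_ge_atTop _
  obtain ⟨N, hNge, hNpow⟩ := ((eventually_ge_atTop (max N₀ N₁)).and hev).exists
  have hN₀ : N₀ ≤ N := le_trans (le_max_left _ _) hNge
  have hN₁ : N₁ ≤ N := le_trans (le_max_right _ _) hNge
  have h1 := hC N hN₀
  have h2 := hfl N hN₁
  have key : C / (N : ℝ) ^ ((1 - s) / 2) < e₀ := by
    rcases (Real.rpow_nonneg (Nat.cast_nonneg N) ((1 - s) / 2)).eq_or_lt with h0 | hpos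
    · rw [← h0, div_zero]; exact he₀
    · rw [div_lt_iff₀ hpos]
      have h3 : e₀ * (C / e₀ + 1) ≤ e₀ * (N : ℝ) ^ ((1 - s) / 2) := mul_le_mul_of_nonneg_left hNpow he₀.le
      have e : e₀ * (C / e₀ + 1) = C + e₀ := by field_simp
      linarith
  linarith

/-- **(O₋₁ᶜ) ⟹ (O₁ᶜ)** — the intensive odd corrector contains g101's common leg S4o of 11071 and 9121 (`oddCorrectorGrade_mono`), so the
proposed residual set `N_F ⟸ (O₋₁ᶜ) ∧ S1r′` keeps the 9121 door `9121 ⟸ S1r′ ∧ (O₁ᶜ)` served. [frame] -/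
theorem oddCorrectorGrade_one_of_neg_one (hO : OddCorrectorGrade (-1)) : OddCorrectorGrade 1 :=
  oddCorrectorGrade_mono (by norm_num) hO

end OddSectorGreenKubo

end Summit.AtomisticToContinuum.FouriersLaw.Theorems.BoundedResponse.ParityFloor

end
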